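import Summits.KontsevichZagierPeriods.KontsevichZagierPeriods.Theses.TerasomaMultiplication
import Summits.KontsevichZagierPeriods.KontsevichZagierPeriods.Theorems.TerasomaMultiplicationBetaCancellationOfAyoubPiCancellation
import Literature.NumberTheory.Transcendental.KZProductIdeal
import Summits.KontsevichZagierPeriods.KontsevichZagierPeriods.Theorems.CompleteModGammaSector.Negative.LoadBearing
import Summits.KontsevichZagierPeriods.KontsevichZagierPeriods.Theorems.FurushoPentagonReducedPeriodRingCubeMerge
import Literature.NumberTheory.Transcendental.KZCalculusProofs

/-!
# Leaf 1 `CubeNashNormalForm` (= item stmt-KontsevichZagierPeriods-3574) — birth skeleton (cstrat-14233-r1)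

Two registered stubs and the kernel-checked composition `CubeNashNormalForm_of`. The seam is the
classical one of real algebraic geometry: INTERIOR (Nash cell decomposition: every rational-shape
representation is a `ℤ`-combination of representations over the OPEN unit cube with integrand analytic
on the open cube — o-minimal cell decomposition with Nash cells, each Nash-diffeomorphic to `(0,1)ⁿ`,
used as rule-(2) moves, lower-dimensional cells null by rule (1a)) versus BOUNDARY (rectilinearisation:
an integrable Nash integrand on the open cube becomes analytic up to the CLOSED cube after finitely
many blow-up / ramification substitutions `xᵢ = uᵢ^q` on sub-cubes — Hironaka 1973, Bierstone–Milman
1988 Thm. 0.2 (rectilinearization), Parusiński 1994; Abhyankar–Jung for quasi-ordinary branches). Neither stub is the leaf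
(the first does not reach the closed cube, the second does not start from a rational shape), neither
constrains a value. Dimension `≤ 1` of the whole leaf is landed (`cubeResolution_dimLEOne`).
[Bochnak–Coste–Roy 1998 §2.9, §8.1; Bierstone–Milman 1988; Ayoub 2014 Rem. 12]
-/

noncomputable section
set_option linter.dupNamespace false

namespace Summit.KontsevichZagierPeriods.KontsevichZagierPeriods.Cruxes.CompleteModGammaSector.BirthCubeNashNormalForm

open MeasureTheory Set
open Literature.NumberTheory.Transcendental
open Literature.NumberTheory.Transcendental.KZ hiding cubicalSpan

/-- Leaf 1 verbatim (item stmt-KontsevichZagierPeriods-3574). -/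
def CubeNashNormalForm : Prop :=
  ∀ (k k' : ℕ) (r : Literature.NumberTheory.Transcendental.KZ.IntegralRep k) (r' : Literature.NumberTheory.Transcendental.KZ.IntegralRep k'), r.IsRational → r'.IsRational → ∃ (S : ℕ) (n : Fin S → ℕ) (g : (i : Fin S) → (Fin (n i) → ℝ) → ℝ) (U : (i : Fin S) → Set (Fin (n i) → ℝ)) (ε : Fin S → ℤ) (s : (i : Fin S) → Literature.NumberTheory.Transcendental.KZ.IntegralRep (n i)), (∀ i, IsOpen (U i) ∧ Set.pi Set.univ (fun _ : Fin (n i) => Set.Icc (0:ℝ) 1) ⊆ (U i) ∧ Literature.NumberTheory.Transcendental.IsSemialgebraicFunOn ℚ (U i) (g i) ∧ AnalyticOnNhd ℝ (g i) (U i)) ∧ (∀ i, (s i).domain = Set.pi Set.univ (fun _ : Fin (n i) => Set.Icc (0:ℝ) 1) ∧ ∀ z ∈ Set.pi Set.univ (fun _ : Fin (n i) => Set.Icc (0:ℝ) 1), (s i).integrand z = g i z) ∧ Literature.NumberTheory.Transcendental.KZ.of r - Literature.NumberTheory.Transcendental.KZ.of r' - ∑ i, ε i • Literature.NumberTheory.Transcendental.KZ.of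 (s i) ∈ Literature.NumberTheory.Transcendental.KZ.relations

/-- Generators of the OPEN-cube Nash span: representations over `(0,1)ⁿ` with integrand analytic on the
open cube (singularities at the boundary allowed, absolutely integrable by definition). [folklore] -/
def openCubeNashGens : Set FormalRep :=
  {d : Literature.NumberTheory.Transcendental.KZ.FormalRep | ∃ (n : ℕ) (s : Literature.NumberTheory.Transcendental.KZ.IntegralRep n), s.domain = {x | ∀ i, 0 < x i ∧ x i < 1} ∧ AnalyticOnNhd ℝ s.integrand {x | ∀ i, 0 < x i ∧ x i < 1} ∧ d = Literature.NumberTheory.Transcendental.KZ.of s}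

/-- **Stub 1 (interior: Nash cell decomposition inside the rules).** Every representation of KZ's
rational shape is, modulo the KZ relations, a `ℤ`-combination of open-cube Nash representations.
[Bochnak–Coste–Roy 1998, Prop. 2.9.10 and §8.1 (Nash cells); Kontsevich–Zagier 2001 §1.2 rules (1a), (2)] -/
theorem stub_nashCellForm : ∀ (k : ℕ) (r : Literature.NumberTheory.Transcendental.KZ.IntegralRep k), r.IsRational → ∃ a ∈ AddSubgroup.closure {d : Literature.NumberTheory.Transcendental.KZ.FormalRep | ∃ (n : ℕ) (s : Literature.NumberTheory.Transcendental.KZ.IntegralRep n), s.domain = {x | ∀ i, 0 < x i ∧ x i < 1} ∧ AnalyticOnNhd ℝ s.integrand {x | ∀ i, 0 < x i ∧ x i < 1} ∧ d = Literature.NumberTheory.Transcendental.KZ.of s}, Literature.NumberTheory.Transcendental.KZ.of r - a ∈ Literature.NumberTheory.Transcendental.KZ.relations := by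
  sorry

/-- **Stub 2 (boundary: rectilinearisation inside the rules; hardest).** Every element of the open-cube
Nash span is, modulo the KZ relations, a `ℤ`-combination of CLOSED-cube representations with integrands
`ℚ`-semialgebraic and analytic on a neighbourhood of `[0,1]ⁿ` (the data of item 3574).
[Bierstone–Milman 1988, Thm. 0.2 (rectilinearization theorem; doi:10.1007/bf02699126, p. 6 read); Hironaka 1973; Parusiński 1994; Ayoub 2014 Rem. 12] -/
theorem stub_boundaryRectilinearisation : ∀ a ∈ AddSubgroup.closure {d : Literature.NumberTheory.Transcendental.KZ.FormalRep | ∃ (n : ℕ) (s : Literature.NumberTheory.Transcendental.KZ.IntegralRep n), s.domain = {x | ∀ i, 0 < x i ∧ x i < 1} ∧ AnalyticOnNhd ℝ s.integrand {x | ∀ i, 0 < x i ∧ x i < 1} ∧ d = Literature.NumberTheory.Transcendental.KZ.of s}, ∃ (S : ℕ) (n : Fin S → ℕ) (g : (i : Fin S) → (Fin (n i) → ℝ) → ℝ) (U : (i : Fin S) → Set (Fin (n i) → ℝ)) (ε : Fin S → ℤ) (s : (i : Fin S) → Literature.NumberTheory.Transcendental.KZ.IntegralRep (n i)), (∀ i,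 IsOpen (U i) ∧ Set.pi Set.univ (fun _ : Fin (n i) => Set.Icc (0:ℝ) 1) ⊆ (U i) ∧ Literature.NumberTheory.Transcendental.IsSemialgebraicFunOn ℚ (U i) (g i) ∧ AnalyticOnNhd ℝ (g i) (U i)) ∧ (∀ i, (s i).domain = Set.pi Set.univ (fun _ : Fin (n i) => Set.Icc (0:ℝ) 1) ∧ ∀ z ∈ Set.pi Set.univ (fun _ : Fin (n i) => Set.Icc (0:ℝ) 1), (s i).integrand z = g i z) ∧ a - ∑ i, ε i • Literature.NumberTheory.Transcendental.KZ.of (s i) ∈ Literature.NumberTheory.Transcendental.KZ.relations := by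
  sorry

/-- **Composition** (kernel-checked): interior + boundary ⇒ the leaf, by subtracting the two open-cube
resolutions and rectilinearising the difference. [folklore] -/
theorem CubeNashNormalForm_of
    (h1 : ∀ (k : ℕ) (r : Literature.NumberTheory.Transcendental.KZ.IntegralRep k), r.IsRational → ∃ a ∈ AddSubgroup.closure {d : Literature.NumberTheory.Transcendental.KZ.FormalRep | ∃ (n : ℕ) (s : Literature.NumberTheory.Transcendental.KZ.IntegralRep n), s.domain = {x | ∀ i, 0 < x i ∧ x i < 1} ∧ AnalyticOnNhd ℝ s.integrand {x | ∀ i, 0 < x i ∧ x i < 1} ∧ d = Literature.NumberTheory.Transcendental.KZ.of s}, Literature.NumberTheory.Transcendental.KZ.of r - a ∈ Literature.NumberTheory.Transcendental.KZ.relations)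
    (h2 : ∀ a ∈ AddSubgroup.closure {d : Literature.NumberTheory.Transcendental.KZ.FormalRep | ∃ (n : ℕ) (s : Literature.NumberTheory.Transcendental.KZ.IntegralRep n), s.domain = {x | ∀ i, 0 < x i ∧ x i < 1} ∧ AnalyticOnNhd ℝ s.integrand {x | ∀ i, 0 < x i ∧ x i < 1} ∧ d = Literature.NumberTheory.Transcendental.KZ.of s}, ∃ (S : ℕ) (n : Fin S → ℕ) (g : (i : Fin S) → (Fin (n i) → ℝ) → ℝ) (U : (i : Fin S) → Set (Fin (n i) → ℝ)) (ε : Fin S → ℤ) (s : (i : Fin S) → Literature.NumberTheory.Transcendental.KZ.IntegralRep (n i)), (∀ i, IsOpen (U i) ∧ Set.pi Set.univ (fun _ : Fin (n i) => Set.Icc (0:ℝ) 1) ⊆ (U i) ∧ Literature.NumberTheory.Transcendental.IsSemialgebraicFunOn ℚ (U i) (g i) ∧ AnalyticOnNhd ℝ (g i) (U i)) ∧ (∀ i, (s i).domain = Set.pi Set.univ (fun _ : Fin (n i) => Set.Icc (0:ℝ) 1) ∧ ∀ z ∈ Set.pi Set.univ (fun _ : Fin (n i) => Set.Icc (0:ℝ)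 1), (s i).integrand z = g i z) ∧ a - ∑ i, ε i • Literature.NumberTheory.Transcendental.KZ.of (s i) ∈ Literature.NumberTheory.Transcendental.KZ.relations) :
    CubeNashNormalForm := by
  intro k k' r r' hr hr'
  obtain ⟨a, ha, hra⟩ := h1 k r hr
  obtain ⟨a', ha', hra'⟩ := h1 k' r' hr'
  obtain ⟨S, n, g, U, ε, s, hg, hs, hrel⟩ := h2 (a - a') (AddSubgroup.sub_mem _ ha ha')
  refine ⟨S, n, g, U, ε, s, hg, hs, ?_⟩
  have : of r - of r' - ∑ i, ε i • of (s i) = (of r - a) - (of r' - a') + (a - a' - ∑ i, ε i • of (s i)) := by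
    abel
  rw [this]
  exact relations.add_mem (relations.sub_mem hra hra') hrel

/-- The leaf from the registered stubs. -/
theorem cubeNashNormalForm_of_stubs : CubeNashNormalForm :=
  CubeNashNormalForm_of stub_nashCellForm stub_boundaryRectilinearisation

end Summit.KontsevichZagierPeriods.KontsevichZagierPeriods.Cruxes.CompleteModGammaSector.BirthCubeNashNormalForm
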